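import Literature.AlgebraicGeometry.ComplexMultiplication.CyclotomicFermatCMTypesPrimePowerCoincidences
import Literature.AlgebraicGeometry.ComplexMultiplication.CyclotomicFermatCMTypesLevelPullback
import HarnessLib

/-!
# Koblitz–Rohrlich THEOREM 3 AS PRINTED — every `n` and every `0 ≤ m ≤ n − 2`: all coincidences `H_τ = H_{τ′}` modulo `3ⁿ`
# between triples of exact `3`-content `3ᵐ`

Layer `Literature/AlgebraicGeometry/ComplexMultiplication`, namespace `…ComplexMultiplication.CyclotomicFermatCMType`; sequel of
`CyclotomicFermatCMTypesPrimePowerCoincidences` (the §4 Proposition = the `m = 0` / g.c.d. `= 1` form of Theorem 3, for every `n`)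
and of `CyclotomicFermatCMTypesLevelPullback` (§1's change of level `H_{(dr,ds,dt)} ↔ H_{(r,s,t)}`).  THEOREMS ONLY (no definition,
no named fact, no `sorry`, no kernel `decide`).  The sibling's honest column: "Theorem 3 is typed in its §4-Proposition form (g.c.d.
`= 1`); the `m ≥ 1` pairs (all six entries divisible by `3ᵐ`) are pull-backs from level `3ⁿ⁻ᵐ` and the verbatim «for `0 ≤ m ≤ n − 2`»
list is not re-assembled" — THIS FILE re-assembles it.

THE SOURCE.  N. Koblitz, D. Rohrlich, *Simple factors in the Jacobian of a Fermat curve*, Canad. J. Math. **30** (1978) 1183–1205,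
THEOREM 3 (p. 1186): "Suppose `N = 3ⁿ`.  Then the only isogenies apart from the obvious ones are between pairs of lattices
corresponding to the triples `(3ᵐ, 3ⁿ⁻¹ − 2(3ᵐ), 2(3ⁿ⁻¹) + 3ᵐ)` and `(3ᵐ⁺¹, 3ⁿ⁻¹ − 2(3ᵐ), 2(3ⁿ⁻¹) − 3ᵐ)` for `0 ≤ m ≤ n − 2`.";
§1 (pp. 1183–1184): "let `M` be the integer defined by `N/M = g.c.d.(N, r, s)` … `H_{r,s}` … subset of `(ℤ/Mℤ)*` … `L_{r,s}` as the
lattice in `ℂ^{φ(M)/2}`"; §4 Proposition (p. 1198, the case g.c.d. `= 1`).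

## What is proved (level `N = 3ᵐ·3ᵏ`, `n = m + k`; entries given as natural numbers `r, …, t′` and triples `τ = (3ᵐr, 3ᵐs, 3ᵐt)`,
## `τ′ = (3ᵐr′, 3ᵐs′, 3ᵐt′)` modulo `N`)

* §1: `pow_mul_natCast_val_castHom` (`3ᵐ·⟨y mod 3ᵏ⟩ = 3ᵐ·y` modulo `3ᵐ3ᵏ`), `natCast_pow_mul_eq`, and
  **`fermatCMType_eq_of_level_mul_eq`**: `H_{τ′} = H_τ` modulo `3ᵐ3ᵏ` ⟹ `H_{(r′,s′,t′)} = H_{(r,s,t)}` modulo `3ᵏ` (units lift: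
  `ZMod.unitsMap_surjective`; pull-back `mem_fermatCMType_level_mul_iff`).
* §2 **`perm_or_exceptional_of_fermatCMType_eq_threePow_mul` — THEOREM 3 AS PRINTED**: for `k ≥ 2`, `r, …, t′` non-zero modulo `3ᵏ`
  with `r + s + t ≡ 0 ≡ r′ + s′ + t′` and one of them prime to `3` (exact `3`-content `3ᵐ`), `H_{τ′} = H_τ` modulo `N` ⟹ `{τ′} = {τ}`, or
  for a unit `w` of `ℤ/N` the pair `(wτ, wτ′)` is `((3ᵐ, 3ᵐ(3ᵏ⁻¹−2), 3ᵐ(2·3ᵏ⁻¹+1)), (3ᵐ·3, 3ᵐ(2·3ᵏ⁻¹−1), 3ᵐ(3ᵏ⁻¹−2)))` up to order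
  inside each triple, or the same with `τ, τ′` exchanged; `threePow_theoremThree_arith` (these are `(3ᵐ, 3ⁿ⁻¹ − 2·3ᵐ, 2·3ⁿ⁻¹ + 3ᵐ)`
  and `(3ᵐ⁺¹, 2·3ⁿ⁻¹ − 3ᵐ, 3ⁿ⁻¹ − 2·3ᵐ)`, `3ᵐ3ᵏ = 3ⁿ`); `multiset_eq_of_fermatCMType_eq_threePow_mul_one` (`k = 1`, i.e. `m = n − 1`:
  only permutations).

## Honest column / NOT here

* The level is written `3ᵐ·3ᵏ` (not `3ⁿ` with `m ≤ n − 2`) so that the change of level is an identity of types; `threePow_theoremThree_arith`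
  supplies the rewriting to K–R's `n`.  Entries are natural numbers multiplied by `3ᵐ` (K–R's integer triples); a triple of residues
  all divisible by `3ᵐ` is of this form (`⟨a⟩ = 3ᵐ·(⟨a⟩/3ᵐ)`), not restated.
* As in every sibling, "isogeny of lattices" = equality of the residue sets `H_τ` read at the full level `N` (the tree's `fermatCMType`);
  the lattices `L_τ ⊂ ℂ^{φ(M)/2}` of the different levels `M` are not constructed, and K–R's "apart from the obvious ones" (unit multiple +
  permutation) is the dichotomy's first branch together with the common unit `w` of the second.
* The proof of the `m = 0` case is the sibling's (parity condition, ours — not K–R's Cases 1–4); this file is the reduction only.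

## References

* [KoblitzRohrlich1978] N. Koblitz, D. Rohrlich, Canad. J. Math. 30 (1978) 1183–1205: Theorem 3 (p. 1186), §1 (pp. 1183–1184), §4
  Proposition (p. 1198).

## Provenance

Cell `pub-hodgecm2` (COR-CM), literature seat `lit-deligne-3` gen 37 (claim KR78-THM3-ALL-M; count-neutral, own lane).
-/

noncomputable section

open NumberField

namespace Literature.AlgebraicGeometry.ComplexMultiplication

open Literature.AlgebraicGeometry.HodgeTheory (fermatCMType)

namespace CyclotomicFermatCMType

/-! ## §1 The change of level `3ᵏ ∣ 3ᵐ·3ᵏ` on Fermat sets and on `3ᵐ`-multiples -/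

section Level

variable {m k : ℕ}

/-- **`3ᵐ·⟨ȳ⟩ = 3ᵐ·y` modulo `3ᵐ·3ᵏ`**: the `3ᵐ`-multiple of a residue `y` modulo `3ᵐ3ᵏ` depends only on `y mod 3ᵏ` — K–R's level
bookkeeping "`L_{r,s} = L_{⟨hr⟩,⟨hs⟩}`", "`H_{r,s}` … subset of `(ℤ/Mℤ)*`, `N/M = g.c.d.(N, r, s)`". [cite: KoblitzRohrlich1978, §1 (pp. 1183–1184)] -/
theorem pow_mul_natCast_val_castHom [NeZero (3 ^ k)] [NeZero (3 ^ m * 3 ^ k)] (y : ZMod (3 ^ m * 3 ^ k)) :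
    ((3 ^ m : ℕ) : ZMod (3 ^ m * 3 ^ k)) * ((ZMod.castHom (dvd_mul_left (3 ^ k) (3 ^ m)) (ZMod (3 ^ k)) y).val : ZMod (3 ^ m * 3 ^ k)) =
      ((3 ^ m : ℕ) : ZMod (3 ^ m * 3 ^ k)) * y := by
  have hv : (ZMod.castHom (dvd_mul_left (3 ^ k) (3 ^ m)) (ZMod (3 ^ k)) y).val = y.val % 3 ^ k := by
    rw [ZMod.castHom_apply, ZMod.cast_eq_val, ZMod.val_natCast]
  conv_rhs => rw [← ZMod.natCast_zmod_val y]
  rw [hv, ← Nat.cast_mul, ← Nat.cast_mul, ZMod.natCast_eq_natCast_iff']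
  have e : 3 ^ m * y.val = 3 ^ m * (y.val % 3 ^ k) + 3 ^ m * 3 ^ k * (y.val / 3 ^ k) := by
    rw [mul_assoc, ← Nat.mul_add, Nat.mod_add_div]
  rw [e, Nat.add_mul_mod_self_left]

/-- The `3ᵐ`-multiple of a natural number `a` modulo `3ᵐ3ᵏ` is the value at `a mod 3ᵏ` of the map `z ↦ 3ᵐ·⟨z⟩`.
[cite: KoblitzRohrlich1978, §1 (pp. 1183–1184)] -/
theorem natCast_pow_mul_eq [NeZero (3 ^ k)] [NeZero (3 ^ m * 3 ^ k)] (a : ℕ) :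
    ((3 ^ m * a : ℕ) : ZMod (3 ^ m * 3 ^ k)) =
      ((3 ^ m : ℕ) : ZMod (3 ^ m * 3 ^ k)) * (((a : ZMod (3 ^ k))).val : ZMod (3 ^ m * 3 ^ k)) := by
  have h := pow_mul_natCast_val_castHom (m := m) (k := k) ((a : ℕ) : ZMod (3 ^ m * 3 ^ k))
  rw [map_natCast] at h
  rw [h, Nat.cast_mul]

/-- **Equal Fermat sets of `3ᵐ`-multiples at level `3ᵐ·3ᵏ` come from equal Fermat sets at level `3ᵏ`** (the units modulo `3ᵐ3ᵏ` map
ONTO the units modulo `3ᵏ`; pull-back `mem_fermatCMType_level_mul_iff`). [cite: KoblitzRohrlich1978, §1 (pp. 1183–1184) and Theorem 3 (p. 1186)] -/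
theorem fermatCMType_eq_of_level_mul_eq [NeZero (3 ^ k)] [NeZero (3 ^ m * 3 ^ k)] {a b c a' b' c' : ℕ}
    (h : fermatCMType (3 ^ m * 3 ^ k) ((3 ^ m * a' : ℕ) : ZMod (3 ^ m * 3 ^ k)) ((3 ^ m * b' : ℕ) : ZMod (3 ^ m * 3 ^ k))
        ((3 ^ m * c' : ℕ) : ZMod (3 ^ m * 3 ^ k)) =
      fermatCMType (3 ^ m * 3 ^ k) ((3 ^ m * a : ℕ) : ZMod (3 ^ m * 3 ^ k)) ((3 ^ m * b : ℕ) : ZMod (3 ^ m * 3 ^ k))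
        ((3 ^ m * c : ℕ) : ZMod (3 ^ m * 3 ^ k))) :
    fermatCMType (3 ^ k) (a' : ZMod (3 ^ k)) (b' : ZMod (3 ^ k)) (c' : ZMod (3 ^ k)) =
      fermatCMType (3 ^ k) (a : ZMod (3 ^ k)) (b : ZMod (3 ^ k)) (c : ZMod (3 ^ k)) := by
  have hd : 0 < 3 ^ m := pow_pos (by norm_num) m
  -- every unit of `ℤ/3ᵏ` lifts to a unit of `ℤ/3ᵐ3ᵏ`
  have key : ∀ {a b c a' b' c' : ℕ},
      fermatCMType (3 ^ m * 3 ^ k) ((3 ^ m * a' : ℕ) : ZMod (3 ^ m * 3 ^ k)) ((3 ^ m * b' : ℕ) : ZMod (3 ^ m * 3 ^ k))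
          ((3 ^ m * c' : ℕ) : ZMod (3 ^ m * 3 ^ k)) =
        fermatCMType (3 ^ m * 3 ^ k) ((3 ^ m * a : ℕ) : ZMod (3 ^ m * 3 ^ k)) ((3 ^ m * b : ℕ) : ZMod (3 ^ m * 3 ^ k))
          ((3 ^ m * c : ℕ) : ZMod (3 ^ m * 3 ^ k)) →
      ∀ z : ZMod (3 ^ k), z ∈ fermatCMType (3 ^ k) (a' : ZMod (3 ^ k)) (b' : ZMod (3 ^ k)) (c' : ZMod (3 ^ k)) →
        z ∈ fermatCMType (3 ^ k) (a : ZMod (3 ^ k)) (b : ZMod (3 ^ k)) (c : ZMod (3 ^ k)) := by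
    intro a b c a' b' c' h z hz
    have hzu : IsUnit z := isUnit_of_mem_fermatCMType hz
    obtain ⟨W, hW⟩ := ZMod.unitsMap_surjective (dvd_mul_left (3 ^ k) (3 ^ m)) hzu.unit
    have hWz : ZMod.castHom (dvd_mul_left (3 ^ k) (3 ^ m)) (ZMod (3 ^ k)) (W : ZMod (3 ^ m * 3 ^ k)) = z := by
      have h1 := congrArg (fun u : (ZMod (3 ^ k))ˣ => (u : ZMod (3 ^ k))) hW
      simp only [ZMod.unitsMap_val, IsUnit.unit_spec] at h1
      rw [ZMod.castHom_apply]
      exact h1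
    have hWc : (W : ZMod (3 ^ m * 3 ^ k)).val.Coprime (3 ^ m * 3 ^ k) := by
      have := (ZMod.isUnit_iff_coprime (W : ZMod (3 ^ m * 3 ^ k)).val (3 ^ m * 3 ^ k))
      rw [ZMod.natCast_zmod_val] at this
      exact this.1 (Units.isUnit W)
    have hmem : (W : ZMod (3 ^ m * 3 ^ k)) ∈ fermatCMType (3 ^ m * 3 ^ k) ((3 ^ m * a' : ℕ) : ZMod (3 ^ m * 3 ^ k))
        ((3 ^ m * b' : ℕ) : ZMod (3 ^ m * 3 ^ k)) ((3 ^ m * c' : ℕ) : ZMod (3 ^ m * 3 ^ k)) := by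
      rw [mem_fermatCMType_level_mul_iff hd, hWz]
      exact ⟨hWc, hz⟩
    rw [h, mem_fermatCMType_level_mul_iff hd, hWz] at hmem
    exact hmem.2
  ext z
  exact ⟨key h z, key h.symm z⟩

end Level

/-! ## §2 THEOREM 3 for every `n = m + k` and every `m` (`k ≥ 2`): coincidences between triples of exact `3`-content `3ᵐ` -/

section TheoremThree

variable {m k : ℕ}

/-- The image of a triple under a map. [folklore] -/
private theorem map_triple {α β : Type*} (F : α → β) (x y z : α) :
    (({x, y, z} : Multiset α).map F) = {F x, F y, F z} := by
  simp only [Multiset.insert_eq_cons, Multiset.map_cons, Multiset.map_singleton]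

/-- **KOBLITZ–ROHRLICH THEOREM 3 AS PRINTED — every `n` and every `0 ≤ m ≤ n − 2`.**  "THEOREM 3. Suppose `N = 3ⁿ`.  Then the only
isogenies apart from the obvious ones are between pairs of lattices corresponding to the triples `(3ᵐ, 3ⁿ⁻¹ − 2(3ᵐ), 2(3ⁿ⁻¹) + 3ᵐ)`
and `(3ᵐ⁺¹, 3ⁿ⁻¹ − 2(3ᵐ), 2(3ⁿ⁻¹) − 3ᵐ)` for `0 ≤ m ≤ n − 2`."  Tree form, at level `N = 3ᵐ·3ᵏ` (`n = m + k`, `k ≥ 2`): let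
`τ = (3ᵐr, 3ᵐs, 3ᵐt)`, `τ′ = (3ᵐr′, 3ᵐs′, 3ᵐt′)` for natural numbers `r, …, t′` that are non-zero modulo `3ᵏ`, with `r + s + t ≡ 0 ≡
r′ + s′ + t′ (mod 3ᵏ)` and one of the six prime to `3` (so `3ᵐ` is the exact common `3`-content: g.c.d.`(N, τ, τ′) = 3ᵐ`).  If
`H_{τ′} = H_τ` modulo `N`, then EITHER `{τ′} = {τ}` OR for a unit `w` modulo `N` the pair `(wτ, wτ′)` is, up to order inside each triple,
`((3ᵐ, 3ᵐ(3ᵏ⁻¹ − 2), 3ᵐ(2·3ᵏ⁻¹ + 1)), (3ᵐ·3, 3ᵐ(2·3ᵏ⁻¹ − 1), 3ᵐ(3ᵏ⁻¹ − 2)))` — i.e. K–R's `((3ᵐ, 3ⁿ⁻¹ − 2·3ᵐ, 2·3ⁿ⁻¹ + 3ᵐ),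
(3ᵐ⁺¹, 2·3ⁿ⁻¹ − 3ᵐ, 3ⁿ⁻¹ − 2·3ᵐ))` (arithmetic: sibling `threePow_triple_eq_mul`) — or the same with `τ, τ′` exchanged.  Reduction to
`m = 0` (`perm_or_exceptional_of_fermatCMType_eq_threePow` at level `3ᵏ`) by the change of level of §1 / sibling
`mem_fermatCMType_level_mul_iff` ("`L_{r,s}` … lattice in `ℂ^{φ(M)/2}`, `N/M = g.c.d.(N, r, s)`").
[cite: KoblitzRohrlich1978, Theorem 3 (p. 1186), §4 Proposition (p. 1198), §1 (pp. 1183–1184)] -/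
theorem perm_or_exceptional_of_fermatCMType_eq_threePow_mul [NeZero (3 ^ k)] [NeZero (3 ^ m * 3 ^ k)] (hk : 2 ≤ k)
    {r s t r' s' t' : ℕ}
    (hr : (r : ZMod (3 ^ k)) ≠ 0) (hs : (s : ZMod (3 ^ k)) ≠ 0) (ht : (t : ZMod (3 ^ k)) ≠ 0)
    (hrst : ((r + s + t : ℕ) : ZMod (3 ^ k)) = 0)
    (hr' : (r' : ZMod (3 ^ k)) ≠ 0) (hs' : (s' : ZMod (3 ^ k)) ≠ 0) (ht' : (t' : ZMod (3 ^ k)) ≠ 0)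
    (hrst' : ((r' + s' + t' : ℕ) : ZMod (3 ^ k)) = 0)
    (hunit : IsUnit (r : ZMod (3 ^ k)) ∨ IsUnit (s : ZMod (3 ^ k)) ∨ IsUnit (t : ZMod (3 ^ k)) ∨
      IsUnit (r' : ZMod (3 ^ k)) ∨ IsUnit (s' : ZMod (3 ^ k)) ∨ IsUnit (t' : ZMod (3 ^ k)))
    (heq : fermatCMType (3 ^ m * 3 ^ k) ((3 ^ m * r' : ℕ) : ZMod (3 ^ m * 3 ^ k)) ((3 ^ m * s' : ℕ) : ZMod (3 ^ m * 3 ^ k))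
        ((3 ^ m * t' : ℕ) : ZMod (3 ^ m * 3 ^ k)) =
      fermatCMType (3 ^ m * 3 ^ k) ((3 ^ m * r : ℕ) : ZMod (3 ^ m * 3 ^ k)) ((3 ^ m * s : ℕ) : ZMod (3 ^ m * 3 ^ k))
        ((3 ^ m * t : ℕ) : ZMod (3 ^ m * 3 ^ k))) :
    ({((3 ^ m * r' : ℕ) : ZMod (3 ^ m * 3 ^ k)), ((3 ^ m * s' : ℕ) : ZMod (3 ^ m * 3 ^ k)), ((3 ^ m * t' : ℕ) : ZMod (3 ^ m * 3 ^ k))} :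
        Multiset (ZMod (3 ^ m * 3 ^ k))) =
      {((3 ^ m * r : ℕ) : ZMod (3 ^ m * 3 ^ k)), ((3 ^ m * s : ℕ) : ZMod (3 ^ m * 3 ^ k)), ((3 ^ m * t : ℕ) : ZMod (3 ^ m * 3 ^ k))} ∨
    ∃ w : ZMod (3 ^ m * 3 ^ k), IsUnit w ∧
      ((({w * ((3 ^ m * r : ℕ) : ZMod (3 ^ m * 3 ^ k)), w * ((3 ^ m * s : ℕ) : ZMod (3 ^ m * 3 ^ k)),
            w * ((3 ^ m * t : ℕ) : ZMod (3 ^ m * 3 ^ k))} : Multiset (ZMod (3 ^ m * 3 ^ k))) =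
          {((3 ^ m * 1 : ℕ) : ZMod (3 ^ m * 3 ^ k)), ((3 ^ m * (3 ^ (k - 1) - 2) : ℕ) : ZMod (3 ^ m * 3 ^ k)),
            ((3 ^ m * (2 * 3 ^ (k - 1) + 1) : ℕ) : ZMod (3 ^ m * 3 ^ k))} ∧
        ({w * ((3 ^ m * r' : ℕ) : ZMod (3 ^ m * 3 ^ k)), w * ((3 ^ m * s' : ℕ) : ZMod (3 ^ m * 3 ^ k)),
            w * ((3 ^ m * t' : ℕ) : ZMod (3 ^ m * 3 ^ k))} : Multiset (ZMod (3 ^ m * 3 ^ k))) =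
          {((3 ^ m * 3 : ℕ) : ZMod (3 ^ m * 3 ^ k)), ((3 ^ m * (2 * 3 ^ (k - 1) - 1) : ℕ) : ZMod (3 ^ m * 3 ^ k)),
            ((3 ^ m * (3 ^ (k - 1) - 2) : ℕ) : ZMod (3 ^ m * 3 ^ k))}) ∨
      (({w * ((3 ^ m * r : ℕ) : ZMod (3 ^ m * 3 ^ k)), w * ((3 ^ m * s : ℕ) : ZMod (3 ^ m * 3 ^ k)),
            w * ((3 ^ m * t : ℕ) : ZMod (3 ^ m * 3 ^ k))} : Multiset (ZMod (3 ^ m * 3 ^ k))) =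
          {((3 ^ m * 3 : ℕ) : ZMod (3 ^ m * 3 ^ k)), ((3 ^ m * (2 * 3 ^ (k - 1) - 1) : ℕ) : ZMod (3 ^ m * 3 ^ k)),
            ((3 ^ m * (3 ^ (k - 1) - 2) : ℕ) : ZMod (3 ^ m * 3 ^ k))} ∧
        ({w * ((3 ^ m * r' : ℕ) : ZMod (3 ^ m * 3 ^ k)), w * ((3 ^ m * s' : ℕ) : ZMod (3 ^ m * 3 ^ k)),
            w * ((3 ^ m * t' : ℕ) : ZMod (3 ^ m * 3 ^ k))} : Multiset (ZMod (3 ^ m * 3 ^ k))) =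
          {((3 ^ m * 1 : ℕ) : ZMod (3 ^ m * 3 ^ k)), ((3 ^ m * (3 ^ (k - 1) - 2) : ℕ) : ZMod (3 ^ m * 3 ^ k)),
            ((3 ^ m * (2 * 3 ^ (k - 1) + 1) : ℕ) : ZMod (3 ^ m * 3 ^ k))})) := by
  classical
  have hk0 : k ≠ 0 := by omega
  -- the level-`3ᵏ` coincidence and Theorem 3 there
  have heqk := fermatCMType_eq_of_level_mul_eq heq
  have hsum : (r : ZMod (3 ^ k)) + s + t = 0 := by exact_mod_cast hrst
  have hsum' : (r' : ZMod (3 ^ k)) + s' + t' = 0 := by exact_mod_cast hrst'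
  -- the transfer map `z ↦ 3ᵐ·⟨z⟩`
  set F : ZMod (3 ^ k) → ZMod (3 ^ m * 3 ^ k) :=
    fun z => ((3 ^ m : ℕ) : ZMod (3 ^ m * 3 ^ k)) * (z.val : ZMod (3 ^ m * 3 ^ k)) with hF
  have hFnat : ∀ a : ℕ, F (a : ZMod (3 ^ k)) = ((3 ^ m * a : ℕ) : ZMod (3 ^ m * 3 ^ k)) := fun a =>
    (natCast_pow_mul_eq a).symm
  rcases perm_or_exceptional_of_fermatCMType_eq_threePow hk0 hr hs ht hsum hr' hs' ht' hsum' hunit heqk with hperm | ⟨w₀, hw₀, hAB⟩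
  · left
    have h := congrArg (Multiset.map F) hperm
    rw [map_triple, map_triple, hFnat, hFnat, hFnat, hFnat, hFnat, hFnat] at h
    exact h
  · right
    -- lift the unit `w₀` of `ℤ/3ᵏ` to a unit `w` of `ℤ/3ᵐ3ᵏ`
    obtain ⟨W, hW⟩ := ZMod.unitsMap_surjective (dvd_mul_left (3 ^ k) (3 ^ m)) hw₀.unit
    have hWw : ZMod.castHom (dvd_mul_left (3 ^ k) (3 ^ m)) (ZMod (3 ^ k)) (W : ZMod (3 ^ m * 3 ^ k)) = w₀ := by
      have h1 := congrArg (fun u : (ZMod (3 ^ k))ˣ => (u : ZMod (3 ^ k))) hW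
      simp only [ZMod.unitsMap_val, IsUnit.unit_spec] at h1
      rw [ZMod.castHom_apply]
      exact h1
    -- `w·3ᵐa = F(w₀·ā)`
    have hmul : ∀ a : ℕ, (W : ZMod (3 ^ m * 3 ^ k)) * ((3 ^ m * a : ℕ) : ZMod (3 ^ m * 3 ^ k)) = F (w₀ * (a : ZMod (3 ^ k))) := by
      intro a
      rw [hF]
      simp only
      rw [← hWw, ← map_natCast (ZMod.castHom (dvd_mul_left (3 ^ k) (3 ^ m)) (ZMod (3 ^ k))) a, ← map_mul,
        pow_mul_natCast_val_castHom, Nat.cast_mul]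
      ring
    -- the exceptional entries as natural numbers modulo `3ᵏ`
    have h2le : 2 ≤ 3 ^ (k - 1) := by
      calc 2 ≤ 3 ^ 1 := by norm_num
        _ ≤ 3 ^ (k - 1) := Nat.pow_le_pow_right (by norm_num) (by omega)
    have h1le : 1 ≤ 2 * 3 ^ (k - 1) := by omega
    have eA1 : (1 : ZMod (3 ^ k)) = ((1 : ℕ) : ZMod (3 ^ k)) := by norm_num
    have eA2 : (3 : ZMod (3 ^ k)) ^ (k - 1) - 2 = ((3 ^ (k - 1) - 2 : ℕ) : ZMod (3 ^ k)) := by push_cast [Nat.cast_sub h2le]; ring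
    have eA3 : 2 * (3 : ZMod (3 ^ k)) ^ (k - 1) + 1 = ((2 * 3 ^ (k - 1) + 1 : ℕ) : ZMod (3 ^ k)) := by push_cast; ring
    have eB1 : (3 : ZMod (3 ^ k)) = ((3 : ℕ) : ZMod (3 ^ k)) := by norm_num
    have eB2 : 2 * (3 : ZMod (3 ^ k)) ^ (k - 1) - 1 = ((2 * 3 ^ (k - 1) - 1 : ℕ) : ZMod (3 ^ k)) := by push_cast [Nat.cast_sub h1le]; ring
    have mapA : (({1, (3 : ZMod (3 ^ k)) ^ (k - 1) - 2, 2 * (3 : ZMod (3 ^ k)) ^ (k - 1) + 1} : Multiset (ZMod (3 ^ k))).map F) =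
        {((3 ^ m * 1 : ℕ) : ZMod (3 ^ m * 3 ^ k)), ((3 ^ m * (3 ^ (k - 1) - 2) : ℕ) : ZMod (3 ^ m * 3 ^ k)),
          ((3 ^ m * (2 * 3 ^ (k - 1) + 1) : ℕ) : ZMod (3 ^ m * 3 ^ k))} := by
      rw [map_triple, eA2, eA3, eA1, hFnat, hFnat, hFnat]
    have mapB : (({3, 2 * (3 : ZMod (3 ^ k)) ^ (k - 1) - 1, (3 : ZMod (3 ^ k)) ^ (k - 1) - 2} : Multiset (ZMod (3 ^ k))).map F) =
        {((3 ^ m * 3 : ℕ) : ZMod (3 ^ m * 3 ^ k)), ((3 ^ m * (2 * 3 ^ (k - 1) - 1) : ℕ) : ZMod (3 ^ m * 3 ^ k)),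
          ((3 ^ m * (3 ^ (k - 1) - 2) : ℕ) : ZMod (3 ^ m * 3 ^ k))} := by
      rw [map_triple, eB2, eA2, eB1, hFnat, hFnat, hFnat]
    have mapτ : (({w₀ * (r : ZMod (3 ^ k)), w₀ * (s : ZMod (3 ^ k)), w₀ * (t : ZMod (3 ^ k))} : Multiset (ZMod (3 ^ k))).map F) =
        {(W : ZMod (3 ^ m * 3 ^ k)) * ((3 ^ m * r : ℕ) : ZMod (3 ^ m * 3 ^ k)),
          (W : ZMod (3 ^ m * 3 ^ k)) * ((3 ^ m * s : ℕ) : ZMod (3 ^ m * 3 ^ k)),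
          (W : ZMod (3 ^ m * 3 ^ k)) * ((3 ^ m * t : ℕ) : ZMod (3 ^ m * 3 ^ k))} := by
      rw [map_triple, hmul, hmul, hmul]
    have mapτ' : (({w₀ * (r' : ZMod (3 ^ k)), w₀ * (s' : ZMod (3 ^ k)), w₀ * (t' : ZMod (3 ^ k))} : Multiset (ZMod (3 ^ k))).map F) =
        {(W : ZMod (3 ^ m * 3 ^ k)) * ((3 ^ m * r' : ℕ) : ZMod (3 ^ m * 3 ^ k)),
          (W : ZMod (3 ^ m * 3 ^ k)) * ((3 ^ m * s' : ℕ) : ZMod (3 ^ m * 3 ^ k)),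
          (W : ZMod (3 ^ m * 3 ^ k)) * ((3 ^ m * t' : ℕ) : ZMod (3 ^ m * 3 ^ k))} := by
      rw [map_triple, hmul, hmul, hmul]
    refine ⟨(W : ZMod (3 ^ m * 3 ^ k)), Units.isUnit W, ?_⟩
    rcases hAB with ⟨hA, hB⟩ | ⟨hB, hA⟩
    · left
      refine ⟨?_, ?_⟩
      · rw [← mapτ, hA, mapA]
      · rw [← mapτ', hB, mapB]
    · right
      refine ⟨?_, ?_⟩
      · rw [← mapτ, hB, mapB]
      · rw [← mapτ', hA, mapA]

/-- **The arithmetic of Theorem 3's triples** (`n = m + k`, `k ≥ 2`): `3ᵐ·1 = 3ᵐ`, `3ᵐ(3ᵏ⁻¹ − 2) = 3ⁿ⁻¹ − 2·3ᵐ`,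
`3ᵐ(2·3ᵏ⁻¹ + 1) = 2·3ⁿ⁻¹ + 3ᵐ`, `3ᵐ·3 = 3ᵐ⁺¹`, `3ᵐ(2·3ᵏ⁻¹ − 1) = 2·3ⁿ⁻¹ − 3ᵐ`, and `3ᵐ·3ᵏ = 3ⁿ` — the previous theorem's triples
are K–R's `(3ᵐ, 3ⁿ⁻¹ − 2(3ᵐ), 2(3ⁿ⁻¹) + 3ᵐ)` and `(3ᵐ⁺¹, 3ⁿ⁻¹ − 2(3ᵐ), 2(3ⁿ⁻¹) − 3ᵐ)`. [cite: KoblitzRohrlich1978, Theorem 3 (p. 1186)] -/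
theorem threePow_theoremThree_arith (hk : 2 ≤ k) :
    3 ^ m * 3 ^ k = 3 ^ (m + k) ∧ 3 ^ m * 1 = 3 ^ m ∧ 3 ^ m * (3 ^ (k - 1) - 2) = 3 ^ (m + k - 1) - 2 * 3 ^ m ∧
      3 ^ m * (2 * 3 ^ (k - 1) + 1) = 2 * 3 ^ (m + k - 1) + 3 ^ m ∧ 3 ^ m * 3 = 3 ^ (m + 1) ∧
      3 ^ m * (2 * 3 ^ (k - 1) - 1) = 2 * 3 ^ (m + k - 1) - 3 ^ m := by
  have h1 : 3 ^ (m + k - 1) = 3 ^ m * 3 ^ (k - 1) := by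
    rw [← pow_add]
    congr 1
    omega
  refine ⟨(pow_add 3 m k).symm, mul_one _, ?_, ?_, (pow_succ 3 m).symm, ?_⟩
  · rw [h1, Nat.mul_sub, mul_comm 2 (3 ^ m)]
  · rw [h1]; ring
  · rw [h1, Nat.mul_sub, mul_one, mul_left_comm]

/-- **The case `m = n − 1` (`k = 1`): triples of `3`-content `3ⁿ⁻¹` coincide only by permutation** — modulo `3` every non-zero
residue is a unit, so the level-`3` coincidence is the relatively prime case (K–R's range `0 ≤ m ≤ n − 2` is sharp at this end
trivially). [cite: KoblitzRohrlich1978, Theorem 3 (p. 1186) and §2 (p. 1188)] -/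
theorem multiset_eq_of_fermatCMType_eq_threePow_mul_one [NeZero (3 ^ 1)] [NeZero (3 ^ m * 3 ^ 1)] {r s t r' s' t' : ℕ}
    (hr : (r : ZMod (3 ^ 1)) ≠ 0) (hs : (s : ZMod (3 ^ 1)) ≠ 0) (ht : (t : ZMod (3 ^ 1)) ≠ 0)
    (hrst : ((r + s + t : ℕ) : ZMod (3 ^ 1)) = 0)
    (hr' : (r' : ZMod (3 ^ 1)) ≠ 0) (hs' : (s' : ZMod (3 ^ 1)) ≠ 0) (ht' : (t' : ZMod (3 ^ 1)) ≠ 0)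
    (hrst' : ((r' + s' + t' : ℕ) : ZMod (3 ^ 1)) = 0)
    (heq : fermatCMType (3 ^ m * 3 ^ 1) ((3 ^ m * r' : ℕ) : ZMod (3 ^ m * 3 ^ 1)) ((3 ^ m * s' : ℕ) : ZMod (3 ^ m * 3 ^ 1))
        ((3 ^ m * t' : ℕ) : ZMod (3 ^ m * 3 ^ 1)) =
      fermatCMType (3 ^ m * 3 ^ 1) ((3 ^ m * r : ℕ) : ZMod (3 ^ m * 3 ^ 1)) ((3 ^ m * s : ℕ) : ZMod (3 ^ m * 3 ^ 1))
        ((3 ^ m * t : ℕ) : ZMod (3 ^ m * 3 ^ 1))) :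
    ({((3 ^ m * r' : ℕ) : ZMod (3 ^ m * 3 ^ 1)), ((3 ^ m * s' : ℕ) : ZMod (3 ^ m * 3 ^ 1)), ((3 ^ m * t' : ℕ) : ZMod (3 ^ m * 3 ^ 1))} :
        Multiset (ZMod (3 ^ m * 3 ^ 1))) =
      {((3 ^ m * r : ℕ) : ZMod (3 ^ m * 3 ^ 1)), ((3 ^ m * s : ℕ) : ZMod (3 ^ m * 3 ^ 1)), ((3 ^ m * t : ℕ) : ZMod (3 ^ m * 3 ^ 1))} := by
  classical
  haveI : Fact (Nat.Prime 3) := ⟨Nat.prime_three⟩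
  have heqk := fermatCMType_eq_of_level_mul_eq heq
  have hsum : (r : ZMod (3 ^ 1)) + s + t = 0 := by exact_mod_cast hrst
  have hsum' : (r' : ZMod (3 ^ 1)) + s' + t' = 0 := by exact_mod_cast hrst'
  -- modulo `3` every non-zero residue is a unit
  have hu : ∀ {z : ZMod (3 ^ 1)}, z ≠ 0 → IsUnit z := by
    intro z hz
    by_contra hzu
    have := two_le_of_not_isUnit (p := 3) hz hzu
    omega
  have hperm := (fermatCMType_eq_iff_multiset_eq_primePow (p := 3) (by norm_num) one_ne_zero (hu hr) (hu hs) (hu ht) hsum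
    (hu hr') (hu hs') (hu ht') hsum').1 heqk
  have h := congrArg (Multiset.map fun z : ZMod (3 ^ 1) =>
    ((3 ^ m : ℕ) : ZMod (3 ^ m * 3 ^ 1)) * (z.val : ZMod (3 ^ m * 3 ^ 1))) hperm
  rw [map_triple, map_triple] at h
  simp only [← natCast_pow_mul_eq] at h
  exact h

end TheoremThree

end CyclotomicFermatCMType

end Literature.AlgebraicGeometry.ComplexMultiplication
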